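import Summits.BirchSwinnertonDyer.BirchSwinnertonDyer.Theorems.ByReductionTypeAtTwoAdditiveKatoTransportDescentModelDoors
import HarnessLib

/-!
# Route ByReductionTypeAtTwo, crux C4″ `AdditivePotMultOverKAtTwo` (stmt-BirchSwinnertonDyer-22618; parent
# `AdditiveRankZeroAtTwo` 19098) — the (−1)-split-twist block doors AT PRINT LEVEL keyed by the Literature CONSTRUCTION fact
# `Kato2004.exists_splitTwistDivisibilityInputsDescent_negOne_two` instead of the Summits `@[conjecture]` constant: the
# model SUPPLIED, Print and Final levels of k4-w3's chain re-run (theorems only; part 2 of 2)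

Cell `bsd-2adic`, seat `bsd-2adic-addL2x` GEN 17. Companion of `…AdditiveKatoTransportDescentDoors.lean` (base and torsion doors
from the fact). FIELD FOR FIELD the (−1)-block theorems of `…PrintExactAnyImageDecomposition.lean` (k4-w3 GEN 4),
`…PrintExactAnyImageModelDoors.lean` §1 (GEN 5), `…PrintExactAnyImagePrintDoors.lean` §1 (GEN 5) and
`…PrintExactAnyImageFinalDoors.lean` §3 (GEN 6), with `hPE : KatoOddBranchInputsAtTwoNegOneSplitTwistPrintExactAnyImage` replaced by
`hDesc : Kato2004.exists_splitTwistDivisibilityInputsDescent_negOne_two` and, below the final level, the normalisation binder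
`hγ5 : κ_cyc(γ) = 5` (which the final door discharges for EVERY generator by the WLOG `γ ↦ γ·c̃`, `c̃ ∈ ker κ` a complex
conjugation — `exists_mem_kerSubgroup_cyclotomicCharacter_mul_eq_five` — and which implies the model doors' `γ·i = i`,
`smul_eq_self_of_sq_eq_neg_one_of_cyclotomicCharacter_eq_five`). Every model / decomposition / functional-equation / isogeny /
non-vanishing ingredient is the cell's existing KERNEL theorem, imported BY NAME (t42 GEN 21–24, k4-w3 GEN 2–6, addL2x GEN 15–16).

* (part 1, `…DescentModelDoors.lean`) the Decomposition door and the doors modulo the model `ΘS` over `F ∋ √−1`.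
* §2′ `…_fe_of_quadraticField` / `…Contra…_fe_of_quadraticField` / `…_fe_of_quadraticField_of_isIsogenous` — model SUPPLIED.
* §3 `katoDivisibility_negOneSplitTwist_two_of_print_of_descent` — print level, `κ_cyc(γ) = 5`.
* §4 **`katoDivisibility_negOneSplitTwist_two_of_descent_of_analyticRank_eq_zero`** — THE (−1)-BLOCK DOORS for EVERY generator
  `γ` matching the cyclotomic variable and `r_an(W) = 0`: the statement of k4-w3's
  `katoDivisibility_negOneSplitTwist_two_of_print_of_analyticRank_eq_zero` VERBATIM with `hPE ↦ hDesc` — from {`Kato2004.thm12_4`,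
  Greenberg Thm. 1.14 ×2, Greenberg Thm. 1.5, modularity `hasEntireLFunction_rat`} (PRINT, BY NAME) + the Literature construction
  fact: `∃ L̃ ∈ Λ`, `ι L̃ = L⁻₂(f, 1, ω, T)`, `L̃ ≠ 0`, with (i) `ℓ_𝔮(X(W/ℚ_∞)) ≤ ℓ_𝔮(Λ/(L̃))` at every height-one `𝔮 ∌ 2` for
  every key-`γ` dual Selmer datum, (ii) the same for every key-`γ⁻¹` datum, (iii) the same for every key-`γ` datum of every
  `W₁ ∼_ℚ W`.

HONEST FRAMING (D-0036 / D-0054): theorems only — no definition, no named fact, no instance, no `sorry`; route-independent;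
CONDITIONAL on `Kato2004.thm12_4`, `Greenberg1999_thm114_charIdeal_iota_invariant`,
`Greenberg1999.thm114_charIdeal_iota_invariant_splitMult_baseChange`, `Greenberg1999.thm15_isTorsion_multiplicative_rat`,
`hasEntireLFunction_rat` (PRINT, BY NAME) and on the Literature construction fact
`Kato2004.exists_splitTwistDivisibilityInputsDescent_negOne_two` (review lane; debt +1); types-the-object-of (the Iwasawa-level
word of the (−1)-split-twist sub-block of C4″ becomes «PRINT ×5 + ONE Literature construction fact + `r_an(W) = 0` + the
objects themselves», the Summits `@[conjecture]` constant SUPERSEDED for this block); closes none (the block target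
`KatoSharpAtTwoAdditiveNegOneSplitTwist` still needs the descent READING T1–T14 and, on the irreducible part, (A)); nothing
booked; BSD is not proved by any of this. NOT HERE: the (−2)-block (reached from the (−1) statements at the twist by `2` by the
cell's kernel R15 at the level of the `@[conjecture]` packages; the END-level transport for the fact is a successor item).
PARTITION: X5@2 additive potentially-multiplicative block, the (−1)-split sub-block (169 classes; 128 irreducible, 41
reducible) × `p = 2`.

References: [Kato2004Asterisque] Thm. 12.4 (p. 221), Thm. 12.5 (3) with (12.5.1) (p. 222), Thm. 17.4 (1) (p. 273), §17.13
(pp. 279–280); [GreenbergLNM1716] §1 (p. 60), Thm. 1.5 (p. 61), Thm. 1.14 (p. 68), §4 (p. 107); [Greenberg1989] pp. 101–102;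
[GreenbergVatsal2000] §2 (p. 28); [MazurTateTeitelbaum1986Invent] §I.8, §I.12–I.14, §I.17; [Washington1997] §13.1;
memo `run/shared/lean/pub/bsd-2adic/addL2x/VERDICT-19098-addL2x-GEN17.md`.
-/

set_option autoImplicit false
-- the summit's namespace `Summit.BirchSwinnertonDyer.BirchSwinnertonDyer` (Sub = Summit) trips `dupNamespace`
set_option linter.dupNamespace false

noncomputable section

open scoped Classical MatrixGroups ModularForm NumberField

open Field CongruenceSubgroup WeierstrassCurve IsDedekindDomain Literature.NumberTheory.EllipticCurves
  Literature.NumberTheory.EllipticCurves.ModularForms Literature.NumberTheory.EllipticCurves.IwasawaAlgebra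
  Literature.NumberTheory.EllipticCurves.Module Literature.NumberTheory.EllipticCurves.QuadraticLayer
  Literature.NumberTheory.EllipticCurves.Greenberg1999 Literature.NumberTheory.GaloisRepresentations
  Summit.BirchSwinnertonDyer.BirchSwinnertonDyer.Theorems

namespace Summit.BirchSwinnertonDyer.BirchSwinnertonDyer.Theorems.AddKatoTwo

/-! ## §2′ The model doors with the model SUPPLIED -/

section Field

variable (W : WeierstrassCurve ℚ) [W.IsElliptic] [W.IsGloballyMinimal] [ContinuousSMul ℤ_[2] (W.tateModule 2)]
  (W' : WeierstrassCurve ℚ) [W'.IsElliptic] [W'.IsGloballyMinimal] {V : VariableChange ℚ} (hV : V • W = W'.quadraticTwist (-1))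
  {θ : AlgebraicClosure ℚ} (hθ : θ ^ 2 = algebraMap ℚ (AlgebraicClosure ℚ) (-1))
  {N : ℕ} [NeZero N] (f : CuspForm (Gamma0 N) 2) (κ : ZpExtension ℚ 2) (γ : absoluteGaloisGroup ℚ)
  (hsp : (W.quadraticTwist (-1)).HasSplitMultiplicativeReductionAtPrime 2)
  (hκ : κ.IsCyclotomic) (hγ : κ.IsTopGenerator γ)
  (hγ5 : ((GaloisRep.cyclotomicCharacter ℚ 2 γ : ℤ_[2]ˣ) : ℤ_[2]) = (cyclotomicGenerator 2 : ℤ_[2]))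
  (hf : IsNewformOf (W.quadraticTwist (-1)) f) (I : Kato2004.IwasawaH1Data W 2 κ γ)
  (Lt : IwasawaAlgebra 2) (m : ℕ)
  (hLt : iwasawaToPowerSeries 2 Lt = PowerSeries.C ((2 : ℚ_[2]) ^ m) * padicLFunctionMinusBranchMult f (1 : ℚ_[2]) 1)
  (hLt0 : Lt ≠ 0)

include hV hθ hsp hκ hγ hγ5 hf I hLt hLt0 in
/-- **(−1)-BLOCK DOOR, key `γ`, keyed by the Literature fact, NO model binder** — the model identification over `F ∋ √−1` is
SUPPLIED by t42 GEN 24's `AddKatoTwoQuadLayerModel.exists_selmerInfty_model`. Twin of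
`lengthAt_selmerDual_le_of_oddBranchInputsPrintExactAnyImage_fe_of_quadraticField`.
[cite: Kato2004Asterisque, Thm. 12.4 (p. 221), Thm. 12.5 (3) and (12.5.1) (p. 222), Thm. 17.4 (1) (p. 273), §17.13 (pp. 279–280)]
[cite: GreenbergLNM1716, Thm. 1.5 (p. 61), Thm. 1.14 (p. 68), §4 (p. 107)] [cite: MazurTateTeitelbaum1986Invent, §I.17] -/
theorem lengthAt_selmerDual_le_of_splitTwistDescent_fe_of_quadraticField (h12 : Kato2004.thm12_4)
    (hDesc : Kato2004.exists_splitTwistDivisibilityInputsDescent_negOne_two)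
    (h114 : Greenberg1999_thm114_charIdeal_iota_invariant)
    (h114F : Greenberg1999.thm114_charIdeal_iota_invariant_splitMult_baseChange) (h15 : thm15_isTorsion_multiplicative_rat)
    (FQ : Type) [Field FQ] [NumberField FQ] {θF : FQ} (hθF : θF ^ 2 = -1) (hF2 : Module.finrank ℚ FQ = 2)
    (hFQ : ∀ v : HeightOneSpectrum (𝓞 FQ), (2 : 𝓞 FQ) ∈ v.asIdeal → (W'.baseChange FQ).HasSplitMultiplicativeReductionAt v) :
    ∀ (D : W.SelmerDualData κ γ) (𝔮 : PrimeSpectrum (IwasawaAlgebra 2)), 𝔮.asIdeal.height = 1 →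
      PowerSeries.C (2 : ℤ_[2]) ∉ 𝔮.asIdeal →
      lengthAt (IwasawaAlgebra 2) D.X 𝔮 ≤ lengthAt (IwasawaAlgebra 2) (IwasawaAlgebra 2 ⧸ Ideal.span {Lt}) 𝔮 := by
  intro D 𝔮 h𝔮 hp𝔮
  haveI : Fact (Nat.Prime 2) := ⟨Nat.prime_two⟩
  haveI : (kerStab κ θ).Normal := normal_kerStab κ hθ
  have hγθ : γ • θ = θ := smul_eq_self_of_sq_eq_neg_one_of_cyclotomicCharacter_eq_five hγ5 hθ
  obtain ⟨κF, γF, hκF, hγF, -, -, ΘS, hΘS⟩ :=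
    AddKatoTwoQuadLayerModel.exists_selmerInfty_model κ hκ W' hθ hγ hγθ FQ hθF hF2
  exact lengthAt_selmerDual_le_of_splitTwistDescent_fe_of_model W W' hV hθ f κ γ hsp hκ hγ hγ5 hf I FQ hFQ κF γF hκF hγF
    ((W'.baseChange FQ).selmerDualData κF hγF) ΘS hΘS Lt m hLt hLt0 h12 hDesc h114 h114F h15 D 𝔮 h𝔮 hp𝔮

include hV hθ hsp hκ hγ hγ5 hf I hLt hLt0 in
/-- **(−1)-BLOCK DOOR, key `γ⁻¹`, keyed by the Literature fact, NO model binder** (the PRINT-EXACT currency). Twin of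
`lengthAt_selmerDualContra_le_of_oddBranchInputsPrintExactAnyImage_fe_of_quadraticField`.
[cite: Kato2004Asterisque, Thm. 12.5 (3) and (12.5.1) (p. 222), §17.13 (pp. 279–280)] [cite: GreenbergLNM1716, Thm. 1.14 (p. 68)]
[cite: MazurTateTeitelbaum1986Invent, §I.17] -/
theorem lengthAt_selmerDualContra_le_of_splitTwistDescent_fe_of_quadraticField (h12 : Kato2004.thm12_4)
    (hDesc : Kato2004.exists_splitTwistDivisibilityInputsDescent_negOne_two)
    (h114 : Greenberg1999_thm114_charIdeal_iota_invariant)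
    (h114F : Greenberg1999.thm114_charIdeal_iota_invariant_splitMult_baseChange) (h15 : thm15_isTorsion_multiplicative_rat)
    (FQ : Type) [Field FQ] [NumberField FQ] {θF : FQ} (hθF : θF ^ 2 = -1) (hF2 : Module.finrank ℚ FQ = 2)
    (hFQ : ∀ v : HeightOneSpectrum (𝓞 FQ), (2 : 𝓞 FQ) ∈ v.asIdeal → (W'.baseChange FQ).HasSplitMultiplicativeReductionAt v) :
    ∀ (D' : W.SelmerDualData κ γ⁻¹) (𝔮 : PrimeSpectrum (IwasawaAlgebra 2)), 𝔮.asIdeal.height = 1 →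
      PowerSeries.C (2 : ℤ_[2]) ∉ 𝔮.asIdeal →
      lengthAt (IwasawaAlgebra 2) D'.X 𝔮 ≤ lengthAt (IwasawaAlgebra 2) (IwasawaAlgebra 2 ⧸ Ideal.span {Lt}) 𝔮 := by
  intro D' 𝔮 h𝔮 hp𝔮
  haveI : Fact (Nat.Prime 2) := ⟨Nat.prime_two⟩
  haveI : (kerStab κ θ).Normal := normal_kerStab κ hθ
  have hγθ : γ • θ = θ := smul_eq_self_of_sq_eq_neg_one_of_cyclotomicCharacter_eq_five hγ5 hθ
  obtain ⟨κF, γF, hκF, hγF, -, -, ΘS, hΘS⟩ :=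
    AddKatoTwoQuadLayerModel.exists_selmerInfty_model κ hκ W' hθ hγ hγθ FQ hθF hF2
  exact lengthAt_selmerDualContra_le_of_splitTwistDescent_fe_of_model W W' hV hθ f κ γ hsp hκ hγ hγ5 hf I FQ hFQ κF γF
    hκF hγF ((W'.baseChange FQ).selmerDualData κF hγF) ΘS hΘS Lt m hLt hLt0 h12 hDesc h114 h114F h15 D' 𝔮 h𝔮 hp𝔮

include hV hθ hsp hκ hγ hγ5 hf I hLt hLt0 in
/-- **(−1)-BLOCK MEMBER DOOR, keyed by the Literature fact, NO model binder**: `ℓ_𝔮(X(W₁/ℚ_∞)) ≤ ℓ_𝔮(Λ/(L̃))` at every height-one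
`𝔮 ∌ 2` for EVERY `W₁ ∼_ℚ W` (Kato's member `W_K` of the reducible (−1)-split-twist block included) — the door at `W` transported
along the pseudo-isogeny pair (`lengthAt_selmerDual_eq_of_isIsogenous`). Twin of
`lengthAt_selmerDual_le_of_oddBranchInputsPrintExactAnyImage_fe_of_quadraticField_of_isIsogenous`.
[cite: Kato2004Asterisque, §8.3 (p. 181), Thm. 12.5 (3) and (12.5.1) (p. 222), §17.13 (pp. 279–280)]
[cite: GreenbergVatsal2000, §2 (p. 28)] [cite: GreenbergLNM1716, Thm. 1.14 (p. 68)] -/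
theorem lengthAt_selmerDual_le_of_splitTwistDescent_fe_of_quadraticField_of_isIsogenous (h12 : Kato2004.thm12_4)
    (hDesc : Kato2004.exists_splitTwistDivisibilityInputsDescent_negOne_two)
    (h114 : Greenberg1999_thm114_charIdeal_iota_invariant)
    (h114F : Greenberg1999.thm114_charIdeal_iota_invariant_splitMult_baseChange) (h15 : thm15_isTorsion_multiplicative_rat)
    (FQ : Type) [Field FQ] [NumberField FQ] {θF : FQ} (hθF : θF ^ 2 = -1) (hF2 : Module.finrank ℚ FQ = 2)
    (hFQ : ∀ v : HeightOneSpectrum (𝓞 FQ), (2 : 𝓞 FQ) ∈ v.asIdeal → (W'.baseChange FQ).HasSplitMultiplicativeReductionAt v)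
    (W₁ : WeierstrassCurve ℚ) [W₁.IsElliptic] (hiso : IsIsogenous W W₁) (D₁ : W₁.SelmerDualData κ γ)
    (𝔮 : PrimeSpectrum (IwasawaAlgebra 2)) (h𝔮 : 𝔮.asIdeal.height = 1) (hp𝔮 : PowerSeries.C (2 : ℤ_[2]) ∉ 𝔮.asIdeal) :
    lengthAt (IwasawaAlgebra 2) D₁.X 𝔮 ≤ lengthAt (IwasawaAlgebra 2) (IwasawaAlgebra 2 ⧸ Ideal.span {Lt}) 𝔮 := by
  haveI : Fact (Nat.Prime 2) := ⟨Nat.prime_two⟩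
  have hp𝔮' : PowerSeries.C ((2 : ℕ) : ℤ_[2]) ∉ 𝔮.asIdeal := by exact_mod_cast hp𝔮
  rw [← lengthAt_selmerDual_eq_of_isIsogenous hiso (W.selmerDualData κ hγ) D₁ 𝔮 hp𝔮']
  exact lengthAt_selmerDual_le_of_splitTwistDescent_fe_of_quadraticField W W' hV hθ f κ γ hsp hκ hγ hγ5 hf I Lt m hLt
    hLt0 h12 hDesc h114 h114F h15 FQ hθF hF2 hFQ (W.selmerDualData κ hγ) 𝔮 h𝔮 hp𝔮

/-! ## §3 The (−1)-block doors at print level, `κ_cyc(γ) = 5` -/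

include hV hθ hsp hκ hγ hγ5 hf hLt hLt0 in
/-- **THE (−1)-BLOCK DOORS AT PRINT LEVEL keyed by the Literature fact — key `γ`, key `γ⁻¹` and every `ℚ`-isogenous member at
once, for a generator with `κ_cyc(γ) = 5`**: from {`Kato2004.thm12_4`, Greenberg Thm. 1.14 ×2, Greenberg Thm. 1.5} (PRINT, BY
NAME), the Literature construction fact, and DATA (`W′` with `V • W = W′^{(−1)}`, `θ`, `f`, `F ∋ θ_F` with `θ_F² = −1`,
`L̃ = 2^m·L⁻ ≠ 0`). Twin of `katoDivisibility_negOneSplitTwist_two_of_print_of_input` (`hF` and `I` SUPPLIED as there).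
[cite: Kato2004Asterisque, Thm. 12.4 (p. 221), Thm. 12.5 (3) and (12.5.1) (p. 222), Thm. 17.4 (1) (p. 273), §8.3 (p. 181), §17.13 (pp. 279–280)]
[cite: GreenbergLNM1716, Thm. 1.5 (p. 61), Thm. 1.14 (p. 68), §4 (p. 107)] [cite: GreenbergVatsal2000, §2 (p. 28)]
[cite: MazurTateTeitelbaum1986Invent, §I.17] [cite: Greenberg1989, pp. 101–102 (S^ι)] -/
theorem katoDivisibility_negOneSplitTwist_two_of_print_of_descent (h12 : Kato2004.thm12_4)
    (hDesc : Kato2004.exists_splitTwistDivisibilityInputsDescent_negOne_two)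
    (h114 : Greenberg1999_thm114_charIdeal_iota_invariant)
    (h114F : Greenberg1999.thm114_charIdeal_iota_invariant_splitMult_baseChange) (h15 : thm15_isTorsion_multiplicative_rat)
    (F : Type) [Field F] [NumberField F] {θF : F} (hθF : θF ^ 2 = -1) (hF2 : Module.finrank ℚ F = 2) :
    (∀ (D : W.SelmerDualData κ γ) (𝔮 : PrimeSpectrum (IwasawaAlgebra 2)), 𝔮.asIdeal.height = 1 →
      PowerSeries.C (2 : ℤ_[2]) ∉ 𝔮.asIdeal →
      lengthAt (IwasawaAlgebra 2) D.X 𝔮 ≤ lengthAt (IwasawaAlgebra 2) (IwasawaAlgebra 2 ⧸ Ideal.span {Lt}) 𝔮) ∧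
    (∀ (D' : W.SelmerDualData κ γ⁻¹) (𝔮 : PrimeSpectrum (IwasawaAlgebra 2)), 𝔮.asIdeal.height = 1 →
      PowerSeries.C (2 : ℤ_[2]) ∉ 𝔮.asIdeal →
      lengthAt (IwasawaAlgebra 2) D'.X 𝔮 ≤ lengthAt (IwasawaAlgebra 2) (IwasawaAlgebra 2 ⧸ Ideal.span {Lt}) 𝔮) ∧
    (∀ (W₁ : WeierstrassCurve ℚ) [W₁.IsElliptic], IsIsogenous W W₁ →
      ∀ (D₁ : W₁.SelmerDualData κ γ) (𝔮 : PrimeSpectrum (IwasawaAlgebra 2)), 𝔮.asIdeal.height = 1 →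
      PowerSeries.C (2 : ℤ_[2]) ∉ 𝔮.asIdeal →
      lengthAt (IwasawaAlgebra 2) D₁.X 𝔮 ≤ lengthAt (IwasawaAlgebra 2) (IwasawaAlgebra 2 ⧸ Ideal.span {Lt}) 𝔮) := by
  haveI : Fact (Nat.Prime 2) := ⟨Nat.prime_two⟩
  obtain ⟨I⟩ := Kato2004.nonempty_iwasawaH1Data_holds W 2 κ γ hκ hγ
  have hsp' : W'.HasSplitMultiplicativeReductionAtPrime 2 :=
    hasSplitMultiplicativeReductionAtPrime_twistModel W W' (by norm_num) hV 2 hsp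
  have hF : ∀ v : HeightOneSpectrum (𝓞 F), (2 : 𝓞 F) ∈ v.asIdeal → (W'.baseChange F).HasSplitMultiplicativeReductionAt v :=
    fun v hv ↦ AddKatoTwoQuadLayerModel.hasSplitMultiplicativeReductionAt_baseChange_of_two_mem W' hsp' F v hv
  refine ⟨?_, ?_, ?_⟩
  · exact lengthAt_selmerDual_le_of_splitTwistDescent_fe_of_quadraticField W W' hV hθ f κ γ hsp hκ hγ hγ5 hf I Lt m hLt
      hLt0 h12 hDesc h114 h114F h15 F hθF hF2 hF
  · exact lengthAt_selmerDualContra_le_of_splitTwistDescent_fe_of_quadraticField W W' hV hθ f κ γ hsp hκ hγ hγ5 hf I Lt m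
      hLt hLt0 h12 hDesc h114 h114F h15 F hθF hF2 hF
  · intro W₁ _ hiso D₁ 𝔮 h𝔮 hp𝔮
    exact lengthAt_selmerDual_le_of_splitTwistDescent_fe_of_quadraticField_of_isIsogenous W W' hV hθ f κ γ hsp hκ hγ hγ5 hf
      I Lt m hLt hLt0 h12 hDesc h114 h114F h15 F hθF hF2 hF W₁ hiso D₁ 𝔮 h𝔮 hp𝔮

end Field

/-! ## §4 The (−1)-block doors for EVERY generator and `r_an(W) = 0` -/

section Final

variable (W : WeierstrassCurve ℚ) [W.IsElliptic] [W.IsGloballyMinimal] [ContinuousSMul ℤ_[2] (W.tateModule 2)]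
  (W' : WeierstrassCurve ℚ) [W'.IsElliptic] [W'.IsGloballyMinimal] {V : VariableChange ℚ} (hV : V • W = W'.quadraticTwist (-1))
  {N : ℕ} [NeZero N] (f : CuspForm (Gamma0 N) 2) (κ : ZpExtension ℚ 2) (γ : absoluteGaloisGroup ℚ)
  (hsp : (W.quadraticTwist (-1)).HasSplitMultiplicativeReductionAtPrime 2)
  (hκ : κ.IsCyclotomic) (hγ : κ.IsTopGenerator γ) (hγ' : IsCyclotomicVariable 2 γ)
  (hf : IsNewformOf (W.quadraticTwist (-1)) f)

include hV hsp hκ hγ hγ' hf in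
/-- **THE (−1)-BLOCK DOORS AT PRINT LEVEL — EVERY generator, keyed by the Literature CONSTRUCTION fact instead of the Summits
`@[conjecture]` constant.** For the ADDITIVE `W` whose twist by `−1` is split multiplicative at `2`, with `r_an(W) = 0` (the crux's
hypothesis verbatim), from {`Kato2004.thm12_4`, Greenberg Thm. 1.14 over `ℚ` and over `F`, Greenberg Thm. 1.5, modularity
`hasEntireLFunction_rat`} (PRINT, BY NAME), the Literature fact `Kato2004.exists_splitTwistDivisibilityInputsDescent_negOne_two`
(odd-branch descent package: printed objects of Kato's Lemma 17.12 for the Tate curve at `2` + 12.1 descent + the twist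
dictionary; kernel Coleman map with kernel killed by `2θ`), and the objects `W′`, `f`, `κ`, `γ`: there is `L̃ ∈ Λ = ℤ₂⟦T⟧` with
`ι L̃ = L⁻₂(f, 1, ω, T)` and `L̃ ≠ 0`, such that (i) `ℓ_𝔮(X(W/ℚ_∞)) ≤ ℓ_𝔮(Λ/(L̃))` at every height-one `𝔮 ∌ 2` for every key-`γ`
dual Selmer datum; (ii) the same for every key-`γ⁻¹` datum; (iii) the same for every key-`γ` datum of every `W₁ ∼_ℚ W`. The
statement of `katoDivisibility_negOneSplitTwist_two_of_print_of_analyticRank_eq_zero` with `hPE ↦ hDesc`; proof: §3 at a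
generator `γ₀ = γ·c` with `κ_cyc(γ₀) = 5`, `c ∈ ker κ` (`exists_mem_kerSubgroup_cyclotomicCharacter_mul_eq_five`), then every
datum re-keyed (`forall_selmerDualData_of_rekey`, `…_inv_of_mul`: `ℚ_∞`-objects do not see `c`).
[cite: Kato2004Asterisque, Thm. 12.4 (p. 221), Thm. 12.5 (3) and (12.5.1) (p. 222), Thm. 17.4 (1) (p. 273), Lemma 17.12 (pp. 278–279), §17.13 (pp. 279–280)]
[cite: GreenbergLNM1716, §1 (p. 60), Thm. 1.5 (p. 61), Thm. 1.14 (p. 68), §4 (p. 107)]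
[cite: MazurTateTeitelbaum1986Invent, §I.8 (8.6), §I.12–I.14, §I.17] [cite: Washington1997, §13.1] -/
theorem katoDivisibility_negOneSplitTwist_two_of_descent_of_analyticRank_eq_zero (h12 : Kato2004.thm12_4)
    (hDesc : Kato2004.exists_splitTwistDivisibilityInputsDescent_negOne_two)
    (h114 : Greenberg1999_thm114_charIdeal_iota_invariant)
    (h114F : Greenberg1999.thm114_charIdeal_iota_invariant_splitMult_baseChange) (h15 : thm15_isTorsion_multiplicative_rat)
    (hmod : hasEntireLFunction_rat) (hr : W.analyticRank = 0) :
    ∃ Lt : IwasawaAlgebra 2, iwasawaToPowerSeries 2 Lt = padicLFunctionMinusBranchMult f (1 : ℚ_[2]) 1 ∧ Lt ≠ 0 ∧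
    (∀ (D : W.SelmerDualData κ γ) (𝔮 : PrimeSpectrum (IwasawaAlgebra 2)), 𝔮.asIdeal.height = 1 →
      PowerSeries.C (2 : ℤ_[2]) ∉ 𝔮.asIdeal →
      lengthAt (IwasawaAlgebra 2) D.X 𝔮 ≤ lengthAt (IwasawaAlgebra 2) (IwasawaAlgebra 2 ⧸ Ideal.span {Lt}) 𝔮) ∧
    (∀ (D' : W.SelmerDualData κ γ⁻¹) (𝔮 : PrimeSpectrum (IwasawaAlgebra 2)), 𝔮.asIdeal.height = 1 →
      PowerSeries.C (2 : ℤ_[2]) ∉ 𝔮.asIdeal →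
      lengthAt (IwasawaAlgebra 2) D'.X 𝔮 ≤ lengthAt (IwasawaAlgebra 2) (IwasawaAlgebra 2 ⧸ Ideal.span {Lt}) 𝔮) ∧
    (∀ (W₁ : WeierstrassCurve ℚ) [W₁.IsElliptic], IsIsogenous W W₁ →
      ∀ (D₁ : W₁.SelmerDualData κ γ) (𝔮 : PrimeSpectrum (IwasawaAlgebra 2)), 𝔮.asIdeal.height = 1 →
      PowerSeries.C (2 : ℤ_[2]) ∉ 𝔮.asIdeal →
      lengthAt (IwasawaAlgebra 2) D₁.X 𝔮 ≤ lengthAt (IwasawaAlgebra 2) (IwasawaAlgebra 2 ⧸ Ideal.span {Lt}) 𝔮) := by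
  haveI : Fact (Nat.Prime 2) := ⟨Nat.prime_two⟩
  haveI : (W.quadraticTwist (-1 : ℚ)).IsElliptic := W.isElliptic_quadraticTwist (by norm_num)
  have hL : W.entireLFunction 1 ≠ 0 := (WeierstrassCurve.analyticRank_eq_zero_iff_holds (hmod W)).mp hr
  -- (α) the odd-branch multiple: `W ≅ (W^{(−1)})^{(−1)}`, `W^{(−1)}` split multiplicative at `2` with newform `f`
  have hWtw : ∃ C : VariableChange ℚ, C • (W.quadraticTwist (-1 : ℚ)).quadraticTwist (-1) = W := by
    obtain ⟨C, hC⟩ := W.exists_variableChange_quadraticTwist_one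
    exact ⟨C⁻¹, by rw [quadraticTwist_quadraticTwist, show (-1 : ℚ) * -1 = 1 by norm_num, ← hC, inv_smul_smul]⟩
  obtain ⟨Lt, hLt, hLt0⟩ :=
    exists_iwasawa_lift_oddBranch_ne_zero W (W.quadraticTwist (-1 : ℚ)) hWtw hf hsp hmod hL
  have hLt' : iwasawaToPowerSeries 2 Lt = padicLFunctionMinusBranchMult f (1 : ℚ_[2]) 1 := by
    rw [hLt, pow_zero, map_one, one_mul]
  -- (γ) a model of `ℚ(√−1)` and a square root of `−1` in `ℚ̄`
  obtain ⟨F, _, _, θF, hθF, hF2⟩ := exists_numberField_sq_eq_of_neg (d := -1) (by norm_num)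
  rw [map_neg, map_one] at hθF
  obtain ⟨θ, hθ⟩ := AddKatoTwoQuadLayer.exists_sqrt (-1)
  -- (β) §3 at every generator with `κ_cyc = 5`, then the WLOG
  have key : ∀ γ₀ : absoluteGaloisGroup ℚ, κ.IsTopGenerator γ₀ →
      ((GaloisRep.cyclotomicCharacter ℚ 2 γ₀ : ℤ_[2]ˣ) : ℤ_[2]) = (cyclotomicGenerator 2 : ℤ_[2]) →
      (∀ (D : W.SelmerDualData κ γ₀) (𝔮 : PrimeSpectrum (IwasawaAlgebra 2)), 𝔮.asIdeal.height = 1 →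
        PowerSeries.C (2 : ℤ_[2]) ∉ 𝔮.asIdeal →
        lengthAt (IwasawaAlgebra 2) D.X 𝔮 ≤ lengthAt (IwasawaAlgebra 2) (IwasawaAlgebra 2 ⧸ Ideal.span {Lt}) 𝔮) ∧
      (∀ (D' : W.SelmerDualData κ γ₀⁻¹) (𝔮 : PrimeSpectrum (IwasawaAlgebra 2)), 𝔮.asIdeal.height = 1 →
        PowerSeries.C (2 : ℤ_[2]) ∉ 𝔮.asIdeal →
        lengthAt (IwasawaAlgebra 2) D'.X 𝔮 ≤ lengthAt (IwasawaAlgebra 2) (IwasawaAlgebra 2 ⧸ Ideal.span {Lt}) 𝔮) ∧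
      (∀ (W₁ : WeierstrassCurve ℚ) [W₁.IsElliptic], IsIsogenous W W₁ →
        ∀ (D₁ : W₁.SelmerDualData κ γ₀) (𝔮 : PrimeSpectrum (IwasawaAlgebra 2)), 𝔮.asIdeal.height = 1 →
        PowerSeries.C (2 : ℤ_[2]) ∉ 𝔮.asIdeal →
        lengthAt (IwasawaAlgebra 2) D₁.X 𝔮 ≤ lengthAt (IwasawaAlgebra 2) (IwasawaAlgebra 2 ⧸ Ideal.span {Lt}) 𝔮) :=
    fun γ₀ hγ₀ hγ₀5 ↦ katoDivisibility_negOneSplitTwist_two_of_print_of_descent W W' hV hθ f κ γ₀ hsp hκ hγ₀ hγ₀5 hf Lt 0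
      hLt hLt0 h12 hDesc h114 h114F h15 F hθF hF2
  refine ⟨Lt, hLt', hLt0, ?_⟩
  obtain ⟨c, hc, hγc5⟩ := exists_mem_kerSubgroup_cyclotomicCharacter_mul_eq_five κ hγ'
  obtain ⟨h1, h2, h3⟩ := key (γ * c) (isTopGenerator_mul_of_mem_kerSubgroup κ hγ hc) hγc5
  have h2c : PowerSeries.C ((2 : ℕ) : ℤ_[2]) = PowerSeries.C (2 : ℤ_[2]) := by norm_num
  refine ⟨?_, ?_, ?_⟩
  · have h := forall_selmerDualData_of_rekey (W₀ := W) Lt hc (by simpa only [h2c] using h1)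
    simpa only [h2c] using h
  · have h := forall_selmerDualData_inv_of_mul (W₀ := W) Lt hc (by simpa only [h2c] using h2)
    simpa only [h2c] using h
  · intro W₁ _ hiso
    have h := forall_selmerDualData_of_rekey (W₀ := W₁) Lt hc (by simpa only [h2c] using h3 W₁ hiso)
    simpa only [h2c] using h

end Final

end Summit.BirchSwinnertonDyer.BirchSwinnertonDyer.Theorems.AddKatoTwo

end
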